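import Literature.Analysis.FluidPDE.AncientSimilarityVorticity
import Literature.Analysis.FluidPDE.HelicityDensityTransport
import Mathlib.Analysis.InnerProductSpace.Calculus
import Mathlib.Analysis.Calculus.Gradient.Basic
import HarnessLib

/-!
# First lemmas of the crux idea «horizon-threading-tower» (ns-idea-15; crux `PoloidalLiouville`,
# stmt-NavierStokesRegularity-1222, W1): the ORDER-ONE FLUX IDENTITY and the HEAD–VIRIAL IDENTITY, in the kernel

Support file for crux `PoloidalLiouville` (line «horizon-threading-tower» of planner ns-idea-15 g2,
`Cruxes/PoloidalLiouville/HorizonTowerSketch.lean` §«First lemmas (provable now)»; verdict ns-wall-crit-1 V9 PASS-WITH-PRICE).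
Experiment cell ARM A `pub/ns-exp-scalarLiouville` (D-0160), generation g3.  Pure vector calculus on `ℝ³`; no PDE, no
Navier–Stokes object; nothing here bears on `PoloidalLiouville` / NS regularity.

* `HorizonTower.orderOneFluxIdentity` — the body of the sketch's `OrderOneFluxIdentity` VERBATIM: for `u ∈ C²(ℝ³;ℝ³)` with
  `⟪curl u, y⟫ ≡ 0` (`y = x − x₀`, slice unthreaded to order one), `⟪y, curl(u × curl u)⟫ = ⟪curl u, ∇⟪u, y⟫⟫`.
* `HorizonTower.headVirialIdentity` — the body of `HeadVirialIdentity` VERBATIM (with the sketch's `radialVirial B x₀`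
  unfolded to `fun z => ⟪z − x₀, ∇B z⟫`): for `ω ∈ C¹` tangent to the spheres about `x₀`, `div ω = 0`, `B ∈ C²`,
  `⟪y, curl(∇B × ω)⟫ = ⟪ω, ∇((y·∇)B)⟫`.

PROOF.  `curl(W × Ω) = DW[Ω] − (div W)Ω + (div Ω)W − DΩ[W]` (tree: `curl_cross_apply`); the tangency `⟪Ω, y⟫ ≡ 0`
differentiated in the direction `h` gives `⟪DΩ(x)h, y⟫ = −⟪Ω(x), h⟫` (`inner_fderiv_apply_of_tangent`); `div curl = 0`
(tree: `HelicityDensityTransport.divergence_curl_eq_zero_of_contDiffAt`); and `⟪Ω, ∇⟪W, y⟫⟫ = ⟪DW[Ω], y⟫ + ⟪W, Ω⟫` (product rule for the inner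
product, Riesz).  Both sides reduce to `⟪y, DW[Ω]⟫ + ⟪Ω, W⟫`.

## References
* planner ns-idea-15, `Cruxes/PoloidalLiouville/Ideas/horizon-threading-tower.md`, `…/HorizonTowerSketch.lean`.
* A. J. Majda, A. L. Bertozzi, *Vorticity and Incompressible Flow* (CUP 2002), §1.1 (vector identities). [MajdaBertozziCUP2002]
-/

-- the summit and its single problem share the name (D-0017 nested layout)
set_option linter.dupNamespace false

noncomputable section

namespace Summit.NavierStokesRegularity.NavierStokesRegularity.Theorems.PoloidalLiouville.HorizonTower

open Set Function
open Literature.Analysis.FluidPDE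

/-- **Tangency differentiated.**  If `⟪Ω z, z − x₀⟫ = 0` for all `z` and `Ω` is differentiable at `x`, then
`⟪DΩ(x) h, x − x₀⟫ = −⟪Ω x, h⟫` for every direction `h`. -/
theorem inner_fderiv_apply_of_tangent {Ω : (EuclideanSpace ℝ (Fin 3)) → (EuclideanSpace ℝ (Fin 3))} {x₀ x : (EuclideanSpace ℝ (Fin 3))} (hΩ : DifferentiableAt ℝ Ω x)
    (htan : ∀ z, inner ℝ (Ω z) (z - x₀) = 0) (h : (EuclideanSpace ℝ (Fin 3))) :
    inner ℝ (fderiv ℝ Ω x h) (x - x₀) = - inner ℝ (Ω x) h := by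
  have hg : HasFDerivAt (fun z => inner ℝ (Ω z) (z - x₀))
      ((fderivInnerCLM ℝ (Ω x, x - x₀)).comp ((fderiv ℝ Ω x).prod (ContinuousLinearMap.id ℝ (EuclideanSpace ℝ (Fin 3))))) x :=
    hΩ.hasFDerivAt.inner ℝ ((hasFDerivAt_id x).sub_const x₀)
  have hconst : (fun z => inner ℝ (Ω z) (z - x₀)) = fun _ => (0 : ℝ) := funext htan
  have hzero : fderiv ℝ (fun z => inner ℝ (Ω z) (z - x₀)) x = 0 := by
    rw [hconst]; exact fderiv_const_apply 0
  have h1 := congrArg (fun L : (EuclideanSpace ℝ (Fin 3)) →L[ℝ] ℝ => L h) (hg.fderiv.symm.trans hzero)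
  simp only [ContinuousLinearMap.comp_apply, ContinuousLinearMap.prod_apply, ContinuousLinearMap.id_apply,
    fderivInnerCLM_apply, zero_apply] at h1
  linarith

/-- **`⟪Ω, ∇⟪W, y⟫⟫ = ⟪DW(x)[Ω], y⟫ + ⟪W, Ω⟫`** (`y = x − x₀`), for `W` differentiable at `x`. -/
theorem inner_gradient_inner_sub (W : (EuclideanSpace ℝ (Fin 3)) → (EuclideanSpace ℝ (Fin 3))) (x₀ x : (EuclideanSpace ℝ (Fin 3))) (hW : DifferentiableAt ℝ W x) (a : (EuclideanSpace ℝ (Fin 3))) :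
    inner ℝ a (gradient (fun z => inner ℝ (W z) (z - x₀)) x)
      = inner ℝ (fderiv ℝ W x a) (x - x₀) + inner ℝ (W x) a := by
  have hm : HasFDerivAt (fun z => inner ℝ (W z) (z - x₀))
      ((fderivInnerCLM ℝ (W x, x - x₀)).comp ((fderiv ℝ W x).prod (ContinuousLinearMap.id ℝ (EuclideanSpace ℝ (Fin 3))))) x :=
    hW.hasFDerivAt.inner ℝ ((hasFDerivAt_id x).sub_const x₀)
  rw [gradient, hm.fderiv, real_inner_comm, InnerProductSpace.toDual_symm_apply]
  simp only [ContinuousLinearMap.comp_apply, ContinuousLinearMap.prod_apply, ContinuousLinearMap.id_apply,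
    fderivInnerCLM_apply]
  ring

/-- **`⟪Ω, ∇⟪y, W⟫⟫ = ⟪DW(x)[Ω], y⟫ + ⟪W, Ω⟫`** (the same with the factors of the inner product swapped). -/
theorem inner_gradient_sub_inner (W : (EuclideanSpace ℝ (Fin 3)) → (EuclideanSpace ℝ (Fin 3))) (x₀ x : (EuclideanSpace ℝ (Fin 3))) (hW : DifferentiableAt ℝ W x) (a : (EuclideanSpace ℝ (Fin 3))) :
    inner ℝ a (gradient (fun z => inner ℝ (z - x₀) (W z)) x)
      = inner ℝ (fderiv ℝ W x a) (x - x₀) + inner ℝ (W x) a := by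
  have h : (fun z => inner ℝ (z - x₀) (W z)) = fun z => inner ℝ (W z) (z - x₀) :=
    funext fun z => real_inner_comm _ _
  rw [h]
  exact inner_gradient_inner_sub W x₀ x hW a

/-- **The common value.**  For `W`, `Ω` differentiable at `x`, `Ω` tangent to the spheres about `x₀` and `div Ω(x) = 0`:
`⟪y, curl(W × Ω)(x)⟫ = ⟪DW(x)[Ω x], y⟫ + ⟪W x, Ω x⟫`. -/
theorem inner_curl_cross_of_tangent {W Ω : (EuclideanSpace ℝ (Fin 3)) → (EuclideanSpace ℝ (Fin 3))} {x₀ x : (EuclideanSpace ℝ (Fin 3))} (hW : DifferentiableAt ℝ W x)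
    (hΩ : DifferentiableAt ℝ Ω x) (htan : ∀ z, inner ℝ (Ω z) (z - x₀) = 0)
    (hdiv : VectorCalculus.divergence Ω x = 0) :
    inner ℝ (x - x₀) (curl (fun z => cross (W z) (Ω z)) x)
      = inner ℝ (fderiv ℝ W x (Ω x)) (x - x₀) + inner ℝ (W x) (Ω x) := by
  rw [curl_cross_apply hW hΩ, hdiv, zero_smul, add_zero]
  have h1 : inner ℝ (x - x₀) (Ω x) = 0 := by rw [real_inner_comm]; exact htan x
  have h2 : inner ℝ (x - x₀) (fderiv ℝ Ω x (W x)) = - inner ℝ (Ω x) (W x) := by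
    rw [real_inner_comm]; exact inner_fderiv_apply_of_tangent hΩ htan (W x)
  rw [inner_sub_right, inner_sub_right, inner_smul_right, h1, h2, mul_zero, sub_zero,
    real_inner_comm (fderiv ℝ W x (Ω x)), real_inner_comm (W x)]
  ring

/-- **ORDER-ONE FLUX IDENTITY** (body of the sketch's `OrderOneFluxIdentity`, VERBATIM): for an unthreaded slice,
`⟪y, curl(u × ω)⟫ = ⟪ω, ∇m⟫` with `ω = curl u`, `m = ⟪u, y⟫` — so the order-one threading coefficient is `c₁ = ω·∇m`:
the radial momentum is a first integral along vortex lines iff the slice is unthreaded to order one.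
[cite: MajdaBertozziCUP2002, §1.1 (vector identities)] -/
theorem orderOneFluxIdentity :
    ∀ (u : (EuclideanSpace ℝ (Fin 3)) → (EuclideanSpace ℝ (Fin 3))) (x₀ : (EuclideanSpace ℝ (Fin 3))), ContDiff ℝ 2 u → (∀ x, inner ℝ (curl u x) (x - x₀) = 0) →
    ∀ x, inner ℝ (x - x₀) (curl (fun z => cross (u z) (curl u z)) x)
      = inner ℝ (curl u x) (gradient (fun z => inner ℝ (u z) (z - x₀)) x) := by
  intro u x₀ hu htan x
  have hud : DifferentiableAt ℝ u x := (hu.differentiable (by norm_num)).differentiableAt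
  have hωd : DifferentiableAt ℝ (curl u) x := by
    rw [curl_eq_curlCLM_comp]
    exact curlCLM.differentiableAt.comp x
      (((hu.fderiv_right (m := 1) (by norm_num)).differentiable (by norm_num)).differentiableAt)
  have hdiv : VectorCalculus.divergence (curl u) x = 0 :=
    HelicityDensityTransport.divergence_curl_eq_zero_of_contDiffAt hu.contDiffAt
  rw [inner_curl_cross_of_tangent hud hωd htan hdiv, inner_gradient_inner_sub u x₀ x hud]

/-- **HEAD–VIRIAL IDENTITY** (body of the sketch's `HeadVirialIdentity`, VERBATIM with `radialVirial B x₀ =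
fun z => ⟪z − x₀, ∇B z⟫` unfolded): for `ω ∈ C¹` tangent to the spheres about `x₀` and divergence free, and any `C²`
scalar `B`, `⟪y, curl(∇B × ω)⟫ = ⟪ω, ∇((y·∇)B)⟫`.  Hence the only non-local input to the order-two threading coefficient is
the radial virial of the Bernoulli head differentiated along vortex lines. [cite: MajdaBertozziCUP2002, §1.1 (vector identities)] -/
theorem headVirialIdentity :
    ∀ (ω : (EuclideanSpace ℝ (Fin 3)) → (EuclideanSpace ℝ (Fin 3))) (B : (EuclideanSpace ℝ (Fin 3)) → ℝ) (x₀ : (EuclideanSpace ℝ (Fin 3))), ContDiff ℝ 1 ω → ContDiff ℝ 2 B →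
    (∀ x, inner ℝ (ω x) (x - x₀) = 0) → VectorCalculus.IsDivFree ω →
    ∀ x, inner ℝ (x - x₀) (curl (fun z => cross (gradient B z) (ω z)) x)
      = inner ℝ (ω x) (gradient (fun z => inner ℝ (z - x₀) (gradient B z)) x) := by
  intro ω B x₀ hω hB htan hdiv x
  have hωd : DifferentiableAt ℝ ω x := (hω.differentiable (by norm_num)).differentiableAt
  have hgc : ContDiff ℝ 1 (gradient B) :=
    (InnerProductSpace.toDual ℝ (EuclideanSpace ℝ (Fin 3))).symm.contDiff.comp (hB.fderiv_right (m := 1) le_rfl)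
  have hWd : DifferentiableAt ℝ (gradient B) x := (hgc.differentiable (by norm_num)).differentiableAt
  rw [inner_curl_cross_of_tangent hWd hωd htan (hdiv x), inner_gradient_sub_inner (gradient B) x₀ x hWd]

end Summit.NavierStokesRegularity.NavierStokesRegularity.Theorems.PoloidalLiouville.HorizonTower

end
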